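import Summits.BirchSwinnertonDyer.BirchSwinnertonDyer.Theorems.ResidualThetaTransportAtTwoHeckeThetaPartnerAdicAtTwoTeichmullerTwistPrelim
import HarnessLib

/-!
# The Teichmüller twist: a Größencharakter congruent to a given character (odd conductor)

Route `ResidualThetaTransportAtTwo`, crux K0⁺ `HeckeThetaPartnerAdicAtTwo` (stmt-BirchSwinnertonDyer-20690),
helper §E2 of the line "proof from print".  THEOREMS ONLY (no definition, no named fact, no `sorry`).

Setting: a number field `k`, a rational prime `p` INERT in `k` (`(p)` prime in `𝓞 k`), a ring
isomorphism `e : ℚ̄_p ≃ ℂ` (the tree's `PadicAlgCl.nonempty_ringEquiv_complex`) through which complex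
algebraic numbers are read `p`-adically, an ideal `𝔪 ≠ 0` of `𝓞 k` prime to `p`, a Größencharakter
`ψ₀ mod 𝔪` of some infinity type `(pτ, qτ)` (ideal-theoretic, `IsGrossencharakter`), and ANY function
`χ` on the primes such that `χ`, `ψ₀` are `e`-adic units at the primes `v ∤ p𝔪` and the MATCHING
CONDITION holds: `χ̃((b)) ≡ ψ̃₀((b))` (`e`-adically) for every `b ≢ 0 mod p` with `b ≡ 1 mod 𝔪`.

**Main result** `exists_isGrossencharakter_congr`: there is a Größencharakter `ψ mod 𝔪` of the same
type `(pτ, qτ)` with `ψ(v) ≡ χ(v)` at every `v ∤ p𝔪` and `ψ̃((b)) = ψ̃₀((b)) · u_b`, `u_b` a root of unity of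
order prime to `p` congruent to `χ̃((b))/ψ̃₀((b))`, for every `b` prime to `p𝔪`.  Construction
(classical: "twist by the Teichmüller lift of the reduction of `χ/ψ₀`"): `θ = χ/ψ₀` is an `e`-adic unit
off `p𝔪`, its reductions have bounded order prime to `p` (class number × `#(𝓞 k/𝔪)ˣ`, through the
matching condition), so the Teichmüller section (tree: `exists_teichmullerSection`) turns them into a
multiplicative root-of-unity valued `η` on the ideals prime to `p𝔪`; the matching condition makes `η` a
ray class character `mod 𝔪` on those ideals, and the single prime `(p)` is filled in through an odd
`c₀ ≡ p mod 𝔪`.  Then `ψ = ψ₀ η`.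

References: [NeukirchANT1999] VII §6; [SerreLocalFields1979] II §4 Prop. 8 (Teichmüller
representatives); [Washington1997] §5.1.
-/

set_option autoImplicit false
set_option linter.dupNamespace false

noncomputable section

open scoped NumberField ComplexConjugate
open NumberField IsDedekindDomain IsLocalRing
open Literature.NumberTheory.GaloisRepresentations Literature.NumberTheory.LFunctions

namespace Summit.BirchSwinnertonDyer.BirchSwinnertonDyer.Theorems.HeckeThetaPartner

variable {k : Type} [Field k] [NumberField k] {p : ℕ} [Fact p.Prime]

/-! ### The twist -/

/-- **The Teichmüller twist.**  See the module docstring. [cite: NeukirchANT1999, Ch. VII §6 Def. (6.1)] -/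
theorem exists_isGrossencharakter_congr (e : PadicAlgCl p ≃+* ℂ)
    (hp : (Ideal.span {(p : 𝓞 k)}).IsPrime)
    {𝔪 : Ideal (𝓞 k)} (h𝔪 : 𝔪 ≠ ⊥) (h𝔪p : IsCoprime 𝔪 (Ideal.span {(p : 𝓞 k)}))
    {pτ qτ : InfinitePlace k → ℤ} {ψ₀ χ : HeightOneSpectrum (𝓞 k) → ℂ}
    (hψ₀ : IsGrossencharakter 𝔪 pτ qτ ψ₀)
    (hU : ∀ v : HeightOneSpectrum (𝓞 k), ¬ Ideal.span {(p : 𝓞 k)} ≤ v.asIdeal → ¬ 𝔪 ≤ v.asIdeal →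
      ‖e.symm (χ v)‖ = 1 ∧ ‖e.symm (ψ₀ v)‖ = 1)
    (hM : ∀ b : 𝓞 k, b ≠ 0 → b ∉ Ideal.span {(p : 𝓞 k)} → b - 1 ∈ 𝔪 →
      ‖e.symm (idealPow k χ (Ideal.span {b})) - e.symm (idealPow k ψ₀ (Ideal.span {b}))‖ < 1) :
    ∃ ψ : HeightOneSpectrum (𝓞 k) → ℂ,
      IsGrossencharakter 𝔪 pτ qτ ψ ∧
      (∀ v : HeightOneSpectrum (𝓞 k), ¬ Ideal.span {(p : 𝓞 k)} ≤ v.asIdeal → ¬ 𝔪 ≤ v.asIdeal →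
        ‖e.symm (ψ v) - e.symm (χ v)‖ < 1) ∧
      (∀ b : 𝓞 k, b ≠ 0 → b ∉ Ideal.span {(p : 𝓞 k)} → IsCoprime (Ideal.span {b}) 𝔪 →
        ∃ u : ℂ, (∃ n : ℕ, 0 < n ∧ ¬ p ∣ n ∧ u ^ n = 1) ∧
          idealPow k ψ (Ideal.span {b}) = idealPow k ψ₀ (Ideal.span {b}) * u ∧
          ‖e.symm u * e.symm (idealPow k ψ₀ (Ideal.span {b})) - e.symm (idealPow k χ (Ideal.span {b}))‖ < 1) := by
  classical
  /- ───── 0. the `e`-adic residue map on complex numbers of size `≤ 1` ───── -/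
  set O := padicAlgClIntegers p with hOdef
  obtain ⟨ρ, ρ_mul, ρ_one, ρ_pow, ρ_eq_iff, ρ_ne_zero, ρ_e⟩ := exists_residueMap e
  /- ───── 1. the inert prime `v₀ = (p)` and "good" primes / elements ───── -/
  have hp0 : Ideal.span {(p : 𝓞 k)} ≠ ⊥ := by
    rw [Ne, Ideal.span_singleton_eq_bot]
    exact_mod_cast (Fact.out : p.Prime).ne_zero
  set P : Ideal (𝓞 k) := Ideal.span {(p : 𝓞 k)} with hPdef
  haveI : P.IsPrime := hp
  have hPmax : P.IsMaximal := hp.isMaximal hp0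
  let v₀ : HeightOneSpectrum (𝓞 k) := ⟨P, hp, hp0⟩
  -- a prime is good iff it is neither `(p)` nor a divisor of `𝔪`
  have good_of_le : ∀ {I : Ideal (𝓞 k)}, IsCoprime I P → IsCoprime I 𝔪 →
      ∀ v : HeightOneSpectrum (𝓞 k), I ≤ v.asIdeal → ¬ P ≤ v.asIdeal ∧ ¬ 𝔪 ≤ v.asIdeal := by
    intro I hIP hI𝔪 v hv
    exact ⟨fun h => (isCoprime_iff_forall_not_le hp0).mp hIP v h hv,
      fun h => (isCoprime_iff_forall_not_le h𝔪).mp hI𝔪 v h hv⟩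
  have coprimeP_of_notMem : ∀ {b : 𝓞 k}, b ∉ P → IsCoprime (Ideal.span {b}) P := by
    intro b hb
    refine (isCoprime_iff_forall_not_le hp0).mpr fun v hv hbv => hb ?_
    have : v.asIdeal = P := (hPmax.eq_of_le v.isPrime.ne_top hv).symm
    exact this ▸ hbv (Ideal.mem_span_singleton_self b)
  -- `e`-adic units: the values of `χ̃`, `ψ̃₀` on ideals prime to `p𝔪`
  have unit_χ : ∀ {I : Ideal (𝓞 k)}, I ≠ ⊥ → IsCoprime I P → IsCoprime I 𝔪 →
      ‖e.symm (idealPow k χ I)‖ = 1 := fun hI hIP hI𝔪 =>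
    norm_symm_idealPow_eq_one e χ hI fun v hv => (hU v (good_of_le hIP hI𝔪 v hv).1 (good_of_le hIP hI𝔪 v hv).2).1
  have unit_ψ₀ : ∀ {I : Ideal (𝓞 k)}, I ≠ ⊥ → IsCoprime I P → IsCoprime I 𝔪 →
      ‖e.symm (idealPow k ψ₀ I)‖ = 1 := fun hI hIP hI𝔪 =>
    norm_symm_idealPow_eq_one e ψ₀ hI fun v hv => (hU v (good_of_le hIP hI𝔪 v hv).1 (good_of_le hIP hI𝔪 v hv).2).2
  -- coprimality with `P`, `𝔪` is multiplicative
  have span_ne_bot : ∀ {b : 𝓞 k}, b ≠ 0 → Ideal.span {b} ≠ ⊥ := fun hb => by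
    rwa [Ne, Ideal.span_singleton_eq_bot]
  /- ───── 2. an odd inverse modulo `𝔪` ───── -/
  have exists_odd_inverse : ∀ c : 𝓞 k, IsCoprime (Ideal.span {c}) 𝔪 →
      ∃ d : 𝓞 k, d ∉ P ∧ c * d - 1 ∈ 𝔪 := fun c hc => exists_inverse_mod_notMem hp h𝔪p c hc
  /- ───── 3. the matching condition in residue form, and the congruence `Θ̃((b)) ≡ Θ̃((c))` ───── -/
  -- (M) in residues: `ρ(χ̃(b)) = ρ(ψ̃₀(b))` for `b ∉ P`, `b ≡ 1 mod 𝔪`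
  have hMρ : ∀ b : 𝓞 k, b ≠ 0 → b ∉ P → b - 1 ∈ 𝔪 →
      ρ (idealPow k χ (Ideal.span {b})) = ρ (idealPow k ψ₀ (Ideal.span {b})) := by
    intro b hb0 hbP hb1
    have hcop : IsCoprime (Ideal.span {b}) 𝔪 := by
      refine Ideal.isCoprime_iff_exists.mpr ⟨b, Ideal.mem_span_singleton_self b, 1 - b, ?_, by ring⟩
      simpa using 𝔪.neg_mem hb1
    rw [ρ_eq_iff _ _ (unit_χ (span_ne_bot hb0) (coprimeP_of_notMem hbP) hcop).le
      (unit_ψ₀ (span_ne_bot hb0) (coprimeP_of_notMem hbP) hcop).le]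
    exact hM b hb0 hbP hb1
  -- for `b, c` prime to `p𝔪` with `b ≡ c mod 𝔪`: `ρ(χ̃ b) ρ(ψ̃₀ c) = ρ(χ̃ c) ρ(ψ̃₀ b)`
  have cross_eq : ∀ b c : 𝓞 k, b ≠ 0 → c ≠ 0 → b ∉ P → c ∉ P →
      IsCoprime (Ideal.span {c}) 𝔪 → b - c ∈ 𝔪 →
      ρ (idealPow k χ (Ideal.span {b})) * ρ (idealPow k ψ₀ (Ideal.span {c})) =
        ρ (idealPow k χ (Ideal.span {c})) * ρ (idealPow k ψ₀ (Ideal.span {b})) := by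
    intro b c hb0 hc0 hbP hcP hc𝔪 hbc
    have hb𝔪 : IsCoprime (Ideal.span {b}) 𝔪 := isCoprime_span_of_sub_mem hc𝔪 hbc
    obtain ⟨d, hdP, hcd⟩ := exists_odd_inverse c hc𝔪
    have hd0 : d ≠ 0 := fun h => hdP (h ▸ P.zero_mem)
    have hd𝔪 : IsCoprime (Ideal.span {d}) 𝔪 := by
      refine Ideal.isCoprime_iff_exists.mpr ⟨c * d, Ideal.mem_span_singleton'.mpr ⟨c, rfl⟩, 1 - c * d, ?_, by ring⟩
      simpa using 𝔪.neg_mem hcd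
    have hbd1 : b * d - 1 ∈ 𝔪 := by
      have : b * d - 1 = (b - c) * d + (c * d - 1) := by ring
      rw [this]; exact 𝔪.add_mem (𝔪.mul_mem_right _ hbc) hcd
    have hbdP : b * d ∉ P := fun h => (hp.mem_or_mem h).elim hbP hdP
    have hcdP : c * d ∉ P := fun h => (hp.mem_or_mem h).elim hcP hdP
    have h1 := hMρ (b * d) (mul_ne_zero hb0 hd0) hbdP hbd1
    have h2 := hMρ (c * d) (mul_ne_zero hc0 hd0) hcdP hcd
    rw [← Ideal.span_singleton_mul_span_singleton, idealPow_mul χ (span_ne_bot hb0) (span_ne_bot hd0),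
      idealPow_mul ψ₀ (span_ne_bot hb0) (span_ne_bot hd0)] at h1
    rw [← Ideal.span_singleton_mul_span_singleton, idealPow_mul χ (span_ne_bot hc0) (span_ne_bot hd0),
      idealPow_mul ψ₀ (span_ne_bot hc0) (span_ne_bot hd0)] at h2
    have hdP' : IsCoprime (Ideal.span {d}) P := coprimeP_of_notMem hdP
    have uχb := unit_χ (span_ne_bot hb0) (coprimeP_of_notMem hbP) hb𝔪
    have uχc := unit_χ (span_ne_bot hc0) (coprimeP_of_notMem hcP) hc𝔪
    have uχd := unit_χ (span_ne_bot hd0) hdP' hd𝔪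
    have uψb := unit_ψ₀ (span_ne_bot hb0) (coprimeP_of_notMem hbP) hb𝔪
    have uψc := unit_ψ₀ (span_ne_bot hc0) (coprimeP_of_notMem hcP) hc𝔪
    have uψd := unit_ψ₀ (span_ne_bot hd0) hdP' hd𝔪
    rw [ρ_mul _ _ uχb.le uχd.le, ρ_mul _ _ uψb.le uψd.le] at h1
    rw [ρ_mul _ _ uχc.le uχd.le, ρ_mul _ _ uψc.le uψd.le] at h2
    -- `Xb Xd = Pb Pd`, `Xc Xd = Pc Pd` ⇒ `Xb Pc = Xc Pb`
    have hne : ρ (idealPow k χ (Ideal.span {d})) * ρ (idealPow k ψ₀ (Ideal.span {d})) ≠ 0 :=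
      mul_ne_zero (ρ_ne_zero _ uχd) (ρ_ne_zero _ uψd)
    apply mul_right_cancel₀ hne
    linear_combination ρ (idealPow k ψ₀ (Ideal.span {c})) * ρ (idealPow k ψ₀ (Ideal.span {d})) * h1 -
      ρ (idealPow k ψ₀ (Ideal.span {b})) * ρ (idealPow k ψ₀ (Ideal.span {d})) * h2
  /- ───── 4. a uniform exponent `n`, prime to `p`, killing all residues of `χ(v)/ψ₀(v)` ───── -/
  -- the residue of `θ(v) = χ(v)/ψ₀(v)` at a good prime
  let z : HeightOneSpectrum (𝓞 k) → padicAlgClResidueField p := fun v => ρ (χ v) * (ρ (ψ₀ v))⁻¹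
  obtain ⟨h, hh, hgen⟩ := exists_forall_span_singleton_eq_pow k
  haveI : Finite (𝓞 k ⧸ 𝔪) := Ideal.finiteQuotientOfFreeOfNeBot 𝔪 h𝔪
  set M := Nat.card (𝓞 k ⧸ 𝔪)ˣ with hM
  have hMpos : 0 < M := Nat.card_pos
  have hzpow : ∀ v : HeightOneSpectrum (𝓞 k), ¬ P ≤ v.asIdeal → ¬ 𝔪 ≤ v.asIdeal →
      z v ^ (h * M) = 1 := by
    intro v hvP hv𝔪
    obtain ⟨g, hg⟩ := hgen v
    have hg0 : g ≠ 0 := by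
      intro h0
      rw [h0, Ideal.span_singleton_eq_bot.mpr rfl, eq_comm, ← Ideal.zero_eq_bot, pow_eq_zero_iff hh.ne'] at hg
      exact v.ne_bot (hg.trans Ideal.zero_eq_bot)
    -- `g` is prime to `𝔪` and to `P`
    have hle_of_le : ∀ w : HeightOneSpectrum (𝓞 k), Ideal.span {g} ≤ w.asIdeal → w = v := by
      intro w hw
      rw [hg] at hw
      have hwv : v.asIdeal ≤ w.asIdeal := (Ideal.IsPrime.pow_le_iff hh.ne').mp hw
      exact (HeightOneSpectrum.ext (v.isMaximal.eq_of_le w.isPrime.ne_top hwv)).symm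
    have hg𝔪 : IsCoprime (Ideal.span {g}) 𝔪 :=
      (isCoprime_iff_forall_not_le h𝔪).mpr fun w hw hle => hv𝔪 ((hle_of_le w hle) ▸ hw)
    have hgP : g ∉ P := by
      intro hgP
      have hle : Ideal.span {g} ≤ P := (Ideal.span_singleton_le_iff_mem _).mpr hgP
      exact hvP ((hle_of_le v₀ hle) ▸ le_rfl)
    -- `g^M ≡ 1 mod 𝔪`
    have hunit : IsUnit (Ideal.Quotient.mk 𝔪 g) := by
      obtain ⟨i, hi, j, hj, hij⟩ := Ideal.isCoprime_iff_exists.mp hg𝔪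
      obtain ⟨r, rfl⟩ := Ideal.mem_span_singleton'.mp hi
      refine isUnit_iff_exists_inv.mpr ⟨Ideal.Quotient.mk 𝔪 r, ?_⟩
      rw [← map_mul, mul_comm, eq_comm, ← map_one (Ideal.Quotient.mk 𝔪), Ideal.Quotient.eq,
        ← hij, add_sub_cancel_left]
      exact hj
    have hgM : g ^ M - 1 ∈ 𝔪 := by
      have h1 : (hunit.unit) ^ M = 1 := pow_card_eq_one'
      have h2 : Ideal.Quotient.mk 𝔪 (g ^ M) = 1 := by
        rw [map_pow, ← hunit.unit_spec, ← Units.val_pow_eq_pow_val, h1, Units.val_one]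
      rw [← Ideal.Quotient.eq, h2, map_one]
    have hgMP : g ^ M ∉ P := fun hmem => hgP (hp.mem_of_pow_mem M hmem)
    -- the matching condition at `g^M`
    have hmatch := hMρ (g ^ M) (pow_ne_zero _ hg0) hgMP hgM
    rw [← Ideal.span_singleton_pow, hg, ← pow_mul, idealPow_pow χ v.ne_bot, idealPow_pow ψ₀ v.ne_bot,
      idealPow_asIdeal, idealPow_asIdeal] at hmatch
    obtain ⟨uχ, uψ⟩ := hU v hvP hv𝔪
    rw [ρ_pow _ uχ.le, ρ_pow _ uψ.le] at hmatch
    have hψne : ρ (ψ₀ v) ≠ 0 := ρ_ne_zero _ uψ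
    simp only [z]
    rw [mul_pow, inv_pow, hmatch, mul_inv_cancel₀ (pow_ne_zero _ hψne)]
  -- strip the `p`-part of `h * M`
  obtain ⟨t, n, hpn, hhM⟩ := Nat.exists_eq_pow_mul_and_not_dvd (Nat.mul_pos hh hMpos).ne' p
    (Fact.out : p.Prime).one_lt.ne'
  have hn0 : 0 < n := Nat.pos_of_ne_zero fun h0 => by
    rw [h0, mul_zero] at hhM; exact (Nat.mul_pos hh hMpos).ne' hhM
  have hz : ∀ v : HeightOneSpectrum (𝓞 k), ¬ P ≤ v.asIdeal → ¬ 𝔪 ≤ v.asIdeal → z v ^ n = 1 := by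
    intro v hvP hv𝔪
    refine eq_one_of_pow_prime_pow_eq_one (p := p) t ?_
    rw [← pow_mul, mul_comm, ← hhM]
    exact hzpow v hvP hv𝔪
  /- ───── 5. the Teichmüller lift `η` on the ideals prime to `p𝔪` ───── -/
  obtain ⟨T, hT0, hT1, hTroot, hTmul⟩ := exists_teichmullerSection (p := p) hn0 hpn
  -- values: `η v = e (T (z v))` at a good prime
  let ηg : HeightOneSpectrum (𝓞 k) → ℂ := fun v => e ((T (z v) : O) : PadicAlgCl p)
  have ηg_pow : ∀ v : HeightOneSpectrum (𝓞 k), ¬ P ≤ v.asIdeal → ¬ 𝔪 ≤ v.asIdeal → ηg v ^ n = 1 := by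
    intro v hvP hv𝔪
    simp only [ηg]
    rw [← map_pow, (hTroot _ (hz v hvP hv𝔪)).1, map_one]
  -- the residue `Z(I) = ρ(χ̃ I)/ρ(ψ̃₀ I)` of `Θ̃(I)` and the compatibility `η̃g(I) = e(T(Z I))`
  let Z : Ideal (𝓞 k) → padicAlgClResidueField p := fun I =>
    ρ (idealPow k χ I) * (ρ (idealPow k ψ₀ I))⁻¹
  have Z_asIdeal : ∀ v : HeightOneSpectrum (𝓞 k), Z v.asIdeal = z v := by
    intro v; simp only [Z, z, idealPow_asIdeal]
  have HP : ∀ I : Ideal (𝓞 k), I ≠ ⊥ → IsCoprime I P → IsCoprime I 𝔪 →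
      Z I ^ n = 1 ∧ idealPow k ηg I = e ((T (Z I) : O) : PadicAlgCl p) := by
    intro I
    induction I using UniqueFactorizationMonoid.induction_on_prime with
    | h₁ => intro h0; exact absurd rfl h0
    | h₂ I hI =>
      intro _ _ _
      have hItop : I = ⊤ := Ideal.isUnit_iff.mp hI
      subst hItop
      have hZ : Z ⊤ = 1 := by simp only [Z, idealPow_top, ρ_one, inv_one, mul_one]
      refine ⟨by rw [hZ, one_pow], ?_⟩
      rw [idealPow_top, hZ, hT1]
      simp
    | h₃ J q hJ hq ih =>
      intro hI hIP hI𝔪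
      have hq0 : q ≠ ⊥ := hq.ne_zero
      let v : HeightOneSpectrum (𝓞 k) := ⟨q, Ideal.isPrime_of_prime hq, hq0⟩
      have hqP : IsCoprime q P := hIP.of_mul_left_left
      have hJP : IsCoprime J P := hIP.of_mul_left_right
      have hq𝔪 : IsCoprime q 𝔪 := hI𝔪.of_mul_left_left
      have hJ𝔪 : IsCoprime J 𝔪 := hI𝔪.of_mul_left_right
      have hvP : ¬ P ≤ v.asIdeal := (good_of_le hqP hq𝔪 v le_rfl).1
      have hv𝔪 : ¬ 𝔪 ≤ v.asIdeal := (good_of_le hqP hq𝔪 v le_rfl).2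
      obtain ⟨ihZ, ihη⟩ := ih hJ hJP hJ𝔪
      obtain ⟨uχ, uψ⟩ := hU v hvP hv𝔪
      have uχJ := unit_χ hJ hJP hJ𝔪
      have uψJ := unit_ψ₀ hJ hJP hJ𝔪
      have hZmul : Z (q * J) = z v * Z J := by
        simp only [Z, z]
        rw [idealPow_mul χ hq0 hJ, idealPow_mul ψ₀ hq0 hJ,
          show q = v.asIdeal from rfl, idealPow_asIdeal, idealPow_asIdeal,
          ρ_mul _ _ uχ.le uχJ.le, ρ_mul _ _ uψ.le uψJ.le, mul_inv]
        ring
      have hzv := hz v hvP hv𝔪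
      refine ⟨by rw [hZmul, mul_pow, hzv, ihZ, one_mul], ?_⟩
      rw [idealPow_mul ηg hq0 hJ, show q = v.asIdeal from rfl, idealPow_asIdeal, ihη, hZmul,
        hTmul _ _ hzv ihZ]
      simp only [ηg]
      rw [← map_mul, ← MulMemClass.coe_mul]
  -- congruent good principal ideals have the same `Z`
  have Z_span_eq : ∀ b c : 𝓞 k, b ≠ 0 → c ≠ 0 → b ∉ P → c ∉ P →
      IsCoprime (Ideal.span {c}) 𝔪 → b - c ∈ 𝔪 → Z (Ideal.span {b}) = Z (Ideal.span {c}) := by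
    intro b c hb0 hc0 hbP hcP hc𝔪 hbc
    have hb𝔪 : IsCoprime (Ideal.span {b}) 𝔪 := isCoprime_span_of_sub_mem hc𝔪 hbc
    have h := cross_eq b c hb0 hc0 hbP hcP hc𝔪 hbc
    have uψb := unit_ψ₀ (span_ne_bot hb0) (coprimeP_of_notMem hbP) hb𝔪
    have uψc := unit_ψ₀ (span_ne_bot hc0) (coprimeP_of_notMem hcP) hc𝔪
    have hPb : ρ (idealPow k ψ₀ (Ideal.span {b})) ≠ 0 := ρ_ne_zero _ uψb
    have hPc : ρ (idealPow k ψ₀ (Ideal.span {c})) ≠ 0 := ρ_ne_zero _ uψc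
    simp only [Z]
    rw [mul_inv_eq_iff_eq_mul₀ hPb, mul_assoc, mul_comm _ (ρ (idealPow k ψ₀ (Ideal.span {b}))),
      ← mul_assoc, eq_comm, mul_inv_eq_iff_eq_mul₀ hPc]
    linear_combination -h
  /- ───── 6. the odd representative `c₀ ≡ p mod 𝔪` and the value of `η` at `(p)` ───── -/
  obtain ⟨c₀, hc₀𝔪, hc₀P, hc₀cop⟩ := exists_rep_generator_notMem hp h𝔪p
  have hc₀0 : c₀ ≠ 0 := fun h => hc₀P (h ▸ P.zero_mem)
  -- the character `η`
  let η : HeightOneSpectrum (𝓞 k) → ℂ := fun v =>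
    if P ≤ v.asIdeal then idealPow k ηg (Ideal.span {c₀}) else ηg v
  have η_idealPow : ∀ {I : Ideal (𝓞 k)}, I ≠ ⊥ → IsCoprime I P → idealPow k η I = idealPow k ηg I := by
    intro I hI hIP
    unfold idealPow
    refine finprod_congr fun v => ?_
    by_cases hv : I ≤ v.asIdeal
    · simp only [η, if_neg ((isCoprime_iff_forall_not_le hp0).mp hIP v · hv)]
    · have hc : (Associates.mk v.asIdeal).count (Associates.mk I).factors = 0 := by
        by_contra hc
        exact hv (Ideal.le_of_dvd ((Associates.count_ne_zero_iff_dvd hI v.irreducible).mp hc))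
      rw [hc, pow_zero, pow_zero]
  have η_v₀ : η v₀ = idealPow k ηg (Ideal.span {c₀}) := by
    simp only [η]; rw [if_pos (le_refl P)]
  -- `ρ` of a Teichmüller value
  have ρ_ηT : ∀ w : padicAlgClResidueField p, w ^ n = 1 →
      ‖e.symm (e ((T w : O) : PadicAlgCl p))‖ ≤ 1 ∧ ρ (e ((T w : O) : PadicAlgCl p)) = w := by
    intro w hw
    refine ⟨?_, by rw [ρ_e, (hTroot w hw).2]⟩
    rw [RingEquiv.symm_apply_apply]; exact (padicAlgCl_mem_valuationSubring_iff p _).mp (T w).2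
  /- ───── 7. `η` is a ray class character mod `𝔪` ───── -/
  have hpu : ¬ IsUnit (p : 𝓞 k) := fun hu => hp.ne_top (Ideal.span_singleton_eq_top.mpr hu)
  -- the ray relation on principal ideals prime to `p`
  have ray_good : ∀ b c : 𝓞 k, b ≠ 0 → c ≠ 0 → b ∉ P → c ∉ P →
      IsCoprime (Ideal.span {c}) 𝔪 → b - c ∈ 𝔪 →
      idealPow k ηg (Ideal.span {b}) = idealPow k ηg (Ideal.span {c}) := by
    intro b c hb0 hc0 hbP hcP hc𝔪 hbc
    have hb𝔪 : IsCoprime (Ideal.span {b}) 𝔪 := isCoprime_span_of_sub_mem hc𝔪 hbc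
    rw [(HP _ (span_ne_bot hb0) (coprimeP_of_notMem hbP) hb𝔪).2,
      (HP _ (span_ne_bot hc0) (coprimeP_of_notMem hcP) hc𝔪).2, Z_span_eq b c hb0 hc0 hbP hcP hc𝔪 hbc]
  -- factoring out the powers of `p`: `η̃((p^t b')) = η̃g((c₀^t b'))`
  have idealPow_η_eq : ∀ (t : ℕ) (b' : 𝓞 k), b' ≠ 0 → b' ∉ P →
      idealPow k η (Ideal.span {(p : 𝓞 k) ^ t * b'}) = idealPow k ηg (Ideal.span {c₀ ^ t * b'}) := by
    intro t b' hb'0 hb'P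
    have hpt0 : Ideal.span {(p : 𝓞 k)} ^ t ≠ ⊥ := pow_ne_zero _ hp0
    have hct0 : Ideal.span {c₀} ^ t ≠ ⊥ := pow_ne_zero _ (span_ne_bot hc₀0)
    rw [← Ideal.span_singleton_mul_span_singleton, ← Ideal.span_singleton_pow,
      idealPow_mul η hpt0 (span_ne_bot hb'0), idealPow_pow η hp0,
      show P = v₀.asIdeal from rfl, idealPow_asIdeal, η_v₀,
      η_idealPow (span_ne_bot hb'0) (coprimeP_of_notMem hb'P),
      ← Ideal.span_singleton_mul_span_singleton, ← Ideal.span_singleton_pow,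
      idealPow_mul ηg hct0 (span_ne_bot hb'0), idealPow_pow ηg (span_ne_bot hc₀0)]
  have hη : IsRayClassCharacter 𝔪 η := by
    refine ⟨fun v hv => ?_, fun b c hb0 hc0 hc𝔪 hbc _ => ?_⟩
    · -- unit values
      by_cases hvP : P ≤ v.asIdeal
      · simp only [η, if_pos hvP]
        rw [(HP _ (span_ne_bot hc₀0) (coprimeP_of_notMem hc₀P) hc₀cop).2]
        refine Complex.norm_eq_one_of_pow_eq_one ?_ hn0.ne'
        rw [← map_pow, (hTroot _ (HP _ (span_ne_bot hc₀0) (coprimeP_of_notMem hc₀P) hc₀cop).1).1, map_one]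
      · simp only [η, if_neg hvP]
        exact Complex.norm_eq_one_of_pow_eq_one (ηg_pow v hvP hv) hn0.ne'
    · -- the ray relation
      have hb𝔪 : IsCoprime (Ideal.span {b}) 𝔪 := isCoprime_span_of_sub_mem hc𝔪 hbc
      obtain ⟨t, b', hb'd, hbeq⟩ := WfDvdMonoid.max_power_factor' hb0 hpu
      obtain ⟨u, c', hc'd, hceq⟩ := WfDvdMonoid.max_power_factor' hc0 hpu
      have hb'P : b' ∉ P := fun h => hb'd (Ideal.mem_span_singleton.mp h)
      have hc'P : c' ∉ P := fun h => hc'd (Ideal.mem_span_singleton.mp h)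
      have hb'0 : b' ≠ 0 := by rintro rfl; exact hb0 (by rw [hbeq, mul_zero])
      have hc'0 : c' ≠ 0 := by rintro rfl; exact hc0 (by rw [hceq, mul_zero])
      have hc'𝔪 : IsCoprime (Ideal.span {c'}) 𝔪 := by
        obtain ⟨i, hi, j, hj, hij⟩ := Ideal.isCoprime_iff_exists.mp hc𝔪
        refine Ideal.isCoprime_iff_exists.mpr ⟨i, ?_, j, hj, hij⟩
        exact Ideal.span_singleton_le_span_singleton.mpr ⟨(p : 𝓞 k) ^ u, by rw [hceq, mul_comm]⟩ hi
      rw [hbeq, hceq, idealPow_η_eq t b' hb'0 hb'P, idealPow_η_eq u c' hc'0 hc'P]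
      refine ray_good _ _ (mul_ne_zero (pow_ne_zero _ hc₀0) hb'0) (mul_ne_zero (pow_ne_zero _ hc₀0) hc'0)
        (fun h => (hp.mem_or_mem h).elim (fun h' => hc₀P (hp.mem_of_pow_mem t h')) hb'P)
        (fun h => (hp.mem_or_mem h).elim (fun h' => hc₀P (hp.mem_of_pow_mem u h')) hc'P) ?_ ?_
      · rw [← Ideal.span_singleton_mul_span_singleton, ← Ideal.span_singleton_pow]
        exact (hc₀cop.pow_left).mul_left hc'𝔪
      · -- `c₀^t b' - c₀^u c' ≡ p^t b' - p^u c' = b - c ≡ 0`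
        have hpow : ∀ m : ℕ, c₀ ^ m - (p : 𝓞 k) ^ m ∈ 𝔪 := fun m => by
          obtain ⟨w, hw⟩ := sub_dvd_pow_sub_pow c₀ (p : 𝓞 k) m
          rw [hw]; exact 𝔪.mul_mem_right _ hc₀𝔪
        have : c₀ ^ t * b' - c₀ ^ u * c' =
            (c₀ ^ t - (p : 𝓞 k) ^ t) * b' - (c₀ ^ u - (p : 𝓞 k) ^ u) * c' + (b - c) := by
          rw [hbeq, hceq]; ring
        rw [this]
        exact 𝔪.add_mem (𝔪.sub_mem (𝔪.mul_mem_right _ (hpow t)) (𝔪.mul_mem_right _ (hpow u))) hbc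
  /- ───── 8. the Größencharakter `ψ = ψ₀ · η` ───── -/
  have hηG : IsGrossencharakter 𝔪 (fun _ => 0) (fun _ => 0) η := by
    refine ⟨fun v hv h0 => ?_, fun b c hb0 hc0 hc𝔪 hbc hpos => ?_⟩
    · have := hη.norm_eq_one v hv
      rw [h0, norm_zero] at this
      exact zero_ne_one this
    · rw [hη.idealPow_span_eq b c hb0 hc0 hc𝔪 hbc hpos]
      simp
  have hψ : IsGrossencharakter 𝔪 pτ qτ (fun v => ψ₀ v * η v) := by
    have h := hψ₀.mul hηG
    simpa using h
  refine ⟨fun v => ψ₀ v * η v, hψ, fun v hvP hv𝔪 => ?_, fun b hb0 hbP hb𝔪 => ?_⟩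
  · /- ───── 9a. `ψ(v) ≡ χ(v)` at the good primes ───── -/
    have hηv : η v = ηg v := by simp only [η, if_neg hvP]
    obtain ⟨uχ, uψ⟩ := hU v hvP hv𝔪
    obtain ⟨hle, hρη⟩ := ρ_ηT (z v) (hz v hvP hv𝔪)
    have hle' : ‖e.symm (ψ₀ v * ηg v)‖ ≤ 1 := by
      rw [map_mul, norm_mul]; exact mul_le_one₀ uψ.le (norm_nonneg _) hle
    change ‖e.symm (ψ₀ v * η v) - e.symm (χ v)‖ < 1
    rw [hηv, ← ρ_eq_iff _ _ hle' uχ.le, ρ_mul _ _ uψ.le hle]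
    rw [hρη]
    simp only [z]
    rw [mul_comm, mul_assoc, inv_mul_cancel₀ (ρ_ne_zero _ uψ), mul_one]
  · /- ───── 9b. `ψ̃((b)) = ψ̃₀((b)) · u_b` with `u_b` a congruent root of unity ───── -/
    obtain ⟨hZn, hHb⟩ := HP _ (span_ne_bot hb0) (coprimeP_of_notMem hbP) hb𝔪
    obtain ⟨hle, hρu⟩ := ρ_ηT (Z (Ideal.span {b})) hZn
    refine ⟨idealPow k ηg (Ideal.span {b}), ⟨n, hn0, hpn, ?_⟩, ?_, ?_⟩
    · rw [hHb, ← map_pow, (hTroot _ hZn).1, map_one]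
    · rw [idealPow_mul_fun' ψ₀ η (span_ne_bot hb0), η_idealPow (span_ne_bot hb0) (coprimeP_of_notMem hbP)]
    · have uχb := unit_χ (span_ne_bot hb0) (coprimeP_of_notMem hbP) hb𝔪
      have uψb := unit_ψ₀ (span_ne_bot hb0) (coprimeP_of_notMem hbP) hb𝔪
      rw [hHb]
      have hle' : ‖e.symm (e ((T (Z (Ideal.span {b})) : O) : PadicAlgCl p) * idealPow k ψ₀ (Ideal.span {b}))‖ ≤ 1 := by
        rw [map_mul, norm_mul]; exact mul_le_one₀ hle (norm_nonneg _) uψb.le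
      rw [← map_mul, ← ρ_eq_iff _ _ hle' uχb.le, ρ_mul _ _ hle uψb.le, hρu]
      simp only [Z]
      rw [mul_assoc, inv_mul_cancel₀ (ρ_ne_zero _ uψb), mul_one]

end Summit.BirchSwinnertonDyer.BirchSwinnertonDyer.Theorems.HeckeThetaPartner

end
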